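import Summits.Ventures.HodgeRepro2.PeterssonCompactQuotient

/-!
# The canonical measure on `Γ\𝔹²` and the canonical Petersson inner product

Kernel support for the blind cell pub-hodge-repro2 (seat p2), T5-ID §ID-4(b′).  The quotient measure of
`BallQuotientMeasure.lean` was built from a chosen fundamental domain; by Mathlib's
`QuotientMeasureEqMeasurePreimage.unique` it does not depend on the choice.  For a torsion-free
`S ⊆ Γ_N` (where a fundamental domain exists, `BallFundamentalDomainExists.lean`) this gives a
CANONICAL measure `ballQuotientMeasure` on `S\𝔹²` — positive on open sets, finite when `S\𝔹²` is
compact — and a canonical Petersson inner product `peterssonInner … ballQuotientMeasure`, positive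
definite on continuous weight-`k` forms when the quotient is compact.
-/

namespace Summit.Ventures.HodgeRepro2.ShimuraData

open MeasureTheory

variable {K : Type*} [Field K] [NumberField K] [NumberField.IsCMField K]
    {τ₁ : K →+* ℂ} {H : Matrix (Fin 3) (Fin 3) K}

section Unique

variable {Q : Matrix (Fin 3) (Fin 3) ℂ} (hQ : IsFrame K τ₁ H Q) (S : Subgroup (GL (Fin 3) K))
    (hS : (S : Set (GL (Fin 3) K)) ⊆ unitaryGroup K H)

/-- **The quotient measure does not depend on the fundamental domain.** -/
theorem quotientMeasure_eq_of_isBallFundamentalDomain {D D' : Set ball₂}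
    (hD : IsBallFundamentalDomain hQ S hS D) (hD' : IsBallFundamentalDomain hQ S hS D') :
    quotientMeasure hQ S hS D = quotientMeasure hQ S hS D' := by
  letI := frameAction hQ S hS
  haveI : HasFundamentalDomain S ball₂ bergmanBall := hD.hasFundamentalDomain bergmanBall
  haveI : QuotientMeasureEqMeasurePreimage bergmanBall (quotientMeasure hQ S hS D) :=
    quotientMeasureEqMeasurePreimage_quotientMeasure hQ S hS hD
  haveI : QuotientMeasureEqMeasurePreimage bergmanBall (quotientMeasure hQ S hS D') :=
    quotientMeasureEqMeasurePreimage_quotientMeasure hQ S hS hD'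
  exact QuotientMeasureEqMeasurePreimage.unique (ν := bergmanBall) _ _

end Unique

section Canonical

variable (hH : IsHermitianForm K H)
    (hdef : ∀ τ : K →+* ℂ, NumberField.InfinitePlace.mk τ ≠ NumberField.InfinitePlace.mk τ₁ →
      IsDefiniteAt K τ H)
    {Q : Matrix (Fin 3) (Fin 3) ℂ} (hQ : IsFrame K τ₁ H Q) {𝔪 : Submodule ℤ (Fin 3 → K)}
    (h𝔪 : IsLattice K 𝔪) {N : ℕ} {S : Subgroup (GL (Fin 3) K)}
    (hS : (S : Set (GL (Fin 3) K)) ⊆ shimuraLevel K H 𝔪 N)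
    (htf : IsTorsionFreeSet K (S : Set (GL (Fin 3) K)))

/-- **The canonical measure on `S\𝔹²`** (torsion-free `S ⊆ Γ_N`): the quotient measure of any
fundamental domain. -/
noncomputable def ballQuotientMeasure :
    Measure (ballQuotient hQ S (subset_unitaryGroup_of_subset_shimuraLevel hS)) :=
  quotientMeasure hQ S (subset_unitaryGroup_of_subset_shimuraLevel hS)
    (Classical.choose (exists_isBallFundamentalDomain hH hdef hQ h𝔪 hS htf))

/-- The canonical measure is the quotient measure of every fundamental domain. -/
theorem ballQuotientMeasure_eq {D : Set ball₂}
    (hD : IsBallFundamentalDomain hQ S (subset_unitaryGroup_of_subset_shimuraLevel hS) D) :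
    ballQuotientMeasure hH hdef hQ h𝔪 hS htf =
      quotientMeasure hQ S (subset_unitaryGroup_of_subset_shimuraLevel hS) D :=
  quotientMeasure_eq_of_isBallFundamentalDomain hQ S _
    (Classical.choose_spec (exists_isBallFundamentalDomain hH hdef hQ h𝔪 hS htf)).2 hD

/-- The canonical measure is positive on open sets. -/
theorem isOpenPosMeasure_ballQuotientMeasure :
    (ballQuotientMeasure hH hdef hQ h𝔪 hS htf).IsOpenPosMeasure :=
  isOpenPosMeasure_quotientMeasure hQ S _
    (Classical.choose_spec (exists_isBallFundamentalDomain hH hdef hQ h𝔪 hS htf)).2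

/-- The canonical measure is finite when `S\𝔹²` is compact. -/
theorem isFiniteMeasure_ballQuotientMeasure
    [CompactSpace (ballQuotient hQ S (subset_unitaryGroup_of_subset_shimuraLevel hS))] :
    IsFiniteMeasure (ballQuotientMeasure hH hdef hQ h𝔪 hS htf) :=
  isFiniteMeasure_quotientMeasure_of_compactSpace hQ S _
    (Classical.choose_spec (exists_isBallFundamentalDomain hH hdef hQ h𝔪 hS htf)).2

/-- **The canonical Petersson inner product is positive definite on a compact quotient.** -/
theorem peterssonInner_self_re_pos_ballQuotientMeasure
    [CompactSpace (ballQuotient hQ S (subset_unitaryGroup_of_subset_shimuraLevel hS))]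
    {k : ℕ} {f : (Fin 2 → ℂ) → ℂ} (hf : IsWeightFor τ₁ Q S k f) (hfc : ContinuousOn f ball₂)
    {z₀ : Fin 2 → ℂ} (hz₀ : z₀ ∈ ball₂) (hne : f z₀ ≠ 0) :
    0 < (peterssonInner hQ S (subset_unitaryGroup_of_subset_shimuraLevel hS)
      (ballQuotientMeasure hH hdef hQ h𝔪 hS htf) hf hf).re :=
  peterssonInner_self_re_pos_of_compactSpace hQ S _
    (Classical.choose_spec (exists_isBallFundamentalDomain hH hdef hQ h𝔪 hS htf)).2 hf hfc hz₀ hne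

/-- **Non-degeneracy of the canonical Petersson inner product on a compact quotient.** -/
theorem peterssonInner_self_eq_zero_iff_ballQuotientMeasure
    [CompactSpace (ballQuotient hQ S (subset_unitaryGroup_of_subset_shimuraLevel hS))]
    {k : ℕ} {f : (Fin 2 → ℂ) → ℂ} (hf : IsWeightFor τ₁ Q S k f) (hfc : ContinuousOn f ball₂) :
    peterssonInner hQ S (subset_unitaryGroup_of_subset_shimuraLevel hS)
      (ballQuotientMeasure hH hdef hQ h𝔪 hS htf) hf hf = 0 ↔ ∀ z ∈ ball₂, f z = 0 :=
  peterssonInner_self_eq_zero_iff_of_compactSpace hQ S _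
    (Classical.choose_spec (exists_isBallFundamentalDomain hH hdef hQ h𝔪 hS htf)).2 hf hfc

end Canonical

end Summit.Ventures.HodgeRepro2.ShimuraData
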